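import Summits.QuantumFields.BalabanUV.Beta.TruncatedNil4Calculus
import Summits.QuantumFields.BalabanUV.Beta.RootedHolonomyReflectionHol

/-!
# `BalabanUV.Beta.RootedAveragingInversion` — the μ = α GROUP-LEVEL INVERSION LAW of the centred one-step averaging
# (β sub-cell, row D1 letter chain HR-W-LET, module M2a §2 of an1's plan AN1-28B; an3 gen 33, an1 first refusal)

HONEST FRAMING (cell charter, verbatim): «discharging BetaPertH makes Bałaban's UV stability UNCONDITIONAL — a real
constructive-QFT result; it is NOT the continuum limit and NOT the Clay problem.»  HONEST DEPENDENCY (verbatim): «continuum YM on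
T⁴ ⇐ BetaPertH ∧ nine spine estimates (0/9 proved); BetaPertH ⇐ (D1) ∧ (D4) ∧ CAP+tail; G-an2-4 gates asym, D1 and NE2/3/4.»
DERIVED cell leaf: [folklore] ring algebra over node 12/12b/5ρ (`holG`, `PhiGAt`, `loopCAt`, `segUp`), an1's M1
`RootedHolonomyReflection{,Hol}` (p216288/p216407) and the CUT `TruncatedNil4Calculus` (p220802), all imported BY NAME.  No statement of
Bałaban's papers is typed here, no `[cite:]` tag, no `Prop` is minted, no binder of the β-function wall (`hW`/`hR`/`D1Tel`/`D1Rep`, (D1),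
`BetaPertH`) is instantiated or discharged.  NOT summit progress.

## What this module proves (an1's INTENT AN1-28B, M2a §2, verbatim target)

For a transporter pair `(G, Ḡ)` in any `𝕜`-algebra `S` which is an INVERSE LETTER PAIR (`G_κ(x)·Ḡ_κ(x) = 1 = Ḡ_κ(x)·G_κ(x)`) of
AUGMENTATION ONE (`ag (G κ x) = 1 = ag (Ḡ κ x)` for a `𝕜`-algebra map `ag : S → S₀` whose kernel has vanishing fourfold products —
the binder `h4` of `TruncatedNil4Calculus`), `(2 : 𝕜) ≠ 0`, `L` odd, root `ctr d L`:

* §1 `holG (rev l) = invT (holG l)` and `logT (holG (rev l)) = −logT (holG l)` on letter lists; the augmentation kills the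
  block-averaged logarithm `x_{(μ,y)} := L^{−d} • Σ_b logT hol(loop_{(μ,y),b})` (`ag x = 0`).
* §2 THE STRUCTURE OF THE REFLECTED AVERAGING ON THE AXIS: with `y′ := bref α α y`, `c′ :=` the centred closing segment of `(α, y′)`,
  `Φ^{ρ_c}_{(α,y)}(G^σ, Ḡ^σ) = hol(rev c′) · expT(−x_{(α,y′)})` (`PhiGAt_reflPair_self_eq`) — every image loop is the
  `hol(c′)`-conjugate of an inverse loop at the reflected bond (M1 `holG_reflPair_loopCAt_self_conj`), `logT`/`expT` are conjugation-
  natural (node 12 `logT_conj`/`expT_conj`), `logT ∘ invT = −logT` (CUT), block offsets re-indexed by `bflip` (`sum_box_bflip`).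
* §3 **THE μ = α LAW** (an1 verbatim): `PhiGAt 𝕜 (ctr d L) (reflPair α G Gb) (reflPair α Gb G) L α y * PhiGAt 𝕜 (ctr d L) G Gb L α (bref α α y) = 1`
  and the swapped product; hence `Φ^σ_{(α,y)} = invT Φ_{(α,y′)}` — Φ_b of the reflected configuration on the reflected coarse α-bond is
  THE INVERSE of Φ at the `bref`-partner.  (μ ≠ α is M1's `PhiGAt_sref_of_ne`.)

## What is NOT here
No jet, no chart, no table: M2b (`RootedJetReflection`: the left chart with general background and the reflected chart data) and
the table extraction are the next modules.  Nothing about `mixFFAt`/`vh₂SAt`/`(hM2)`/`(hBe)` is proved in this file.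
-/

namespace Summit.QuantumFields.BalabanUV.Beta.RootedAveragingInversion

open Finset
open scoped BigOperators
open Literature.MathematicalPhysics.QuantumFieldTheory.Balaban1983to89
open Literature.MathematicalPhysics.QuantumFieldTheory.Balaban1983to89.Beta
open AffineAveraging (Form1 box)
open AveragingContours (segUp rev)
open AveragingContoursRooted (loopCAt ctr)
open AveragingHessianKernels (LettersIn)
open AveragingThirdJet (LetterGrp δ holG expT logT invT map_logT logT_one)
open AveragingMixedJetTables (PhiGAt lettersIn_loopCAt_top lettersIn_segUp_top)
open ResolventReflection (bref bflip bflip_mem sum_box_bflip)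
open Summit.QuantumFields.BalabanUV.Beta.RootedHolonomyReflectionHol (reflPair holG_rev_mul holG_mul_rev holG_reflPair_cSeg_self
  holG_reflPair_loopCAt_self_conj)
open Summit.QuantumFields.BalabanUV.Beta.TruncatedNil4Calculus (eq_invT_of_mul_eq_one logT_invT expT_neg_mul_expT expT_mul_expT_neg
  aug_holG_eq_one aug_PhiGAt_eq_one)

variable {𝕜 : Type*} [Field 𝕜] {S S₀ : Type*} [Ring S] [Algebra 𝕜 S] [Ring S₀] [Algebra 𝕜 S₀] {d : ℕ}

/-! ## §1 Reversed lists are truncated inverses; the augmentation kills the averaged logarithm -/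

section Reversed

variable {ag : S →ₐ[𝕜] S₀}
  (h4 : ∀ a b c e : S, ag a = 0 → ag b = 0 → ag c = 0 → ag e = 0 → a * b * c * e = 0)
  {G Gb : Form1 d S} (hG : ∀ κ x, ag (G κ x) = 1) (hGb : ∀ κ x, ag (Gb κ x) = 1)
  (hGGb : ∀ κ x, G κ x * Gb κ x = 1) (hGbG : ∀ κ x, Gb κ x * G κ x = 1)
include h4 hG hGb hGGb hGbG

/-- [folklore] For an inverse letter pair of augmentation one, the holonomy of the REVERSED list is the truncated inverse `invT` of the
holonomy (uniqueness of inverses modulo `𝔪⁴`). -/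
theorem holG_rev_eq_invT {P : (Fin d → ℤ) → Prop} {l : List (LetterGrp d)} (hl : LettersIn δ P l) :
    holG G Gb (rev l) = invT (holG G Gb l) :=
  eq_invT_of_mul_eq_one h4 (aug_holG_eq_one hG hGb hl) (holG_mul_rev hGGb hGbG hl)

/-- [folklore] `logT hol(rev l) = −logT hol(l)` (`(2 : 𝕜) ≠ 0`). -/
theorem logT_holG_rev (h2 : (2 : 𝕜) ≠ 0) {P : (Fin d → ℤ) → Prop} {l : List (LetterGrp d)} (hl : LettersIn δ P l) :
    logT 𝕜 (holG G Gb (rev l)) = -logT 𝕜 (holG G Gb l) := by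
  rw [holG_rev_eq_invT h4 hG hGb hGGb hGbG hl, logT_invT h4 h2 (aug_holG_eq_one hG hGb hl)]

omit h4 hGGb hGbG in
/-- [folklore] The block-averaged logarithm of loop holonomies lies in the augmentation ideal: `ag (L^{−d} • Σ_b logT hol(loop_b)) = 0`. -/
theorem aug_avgLog_eq_zero (ρ : Fin d → ℤ) (L : ℕ) (μ : Fin d) (y : Fin d → ℤ) :
    ag (((L : 𝕜) ^ d)⁻¹ • ∑ b ∈ box d L, logT 𝕜 (holG G Gb (loopCAt ρ δ L μ y b))) = 0 := by
  rw [map_smul, map_sum]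
  have h0 : ∀ b ∈ box d L, ag (logT 𝕜 (holG G Gb (loopCAt ρ δ L μ y b))) = 0 := fun b _ => by
    rw [map_logT, aug_holG_eq_one hG hGb (lettersIn_loopCAt_top ρ δ L μ y b), logT_one]
  rw [Finset.sum_eq_zero h0, smul_zero]

end Reversed

/-! ## §2 The reflected averaging on the axis: image loops are conjugated inverse loops -/

section Axis

variable {ag : S →ₐ[𝕜] S₀}
  (h4 : ∀ a b c e : S, ag a = 0 → ag b = 0 → ag c = 0 → ag e = 0 → a * b * c * e = 0) (h2 : (2 : 𝕜) ≠ 0)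
  {L : ℕ} (hL : Odd L)
  {G Gb : Form1 d S} (hG : ∀ κ x, ag (G κ x) = 1) (hGb : ∀ κ x, ag (Gb κ x) = 1)
  (hGGb : ∀ κ x, G κ x * Gb κ x = 1) (hGbG : ∀ κ x, Gb κ x * G κ x = 1)
include h4 h2 hL hG hGb hGGb hGbG

omit h4 h2 hG hGb in
/-- [folklore] `μ = α`: each image loop holonomy of the reflected pair at `(α, y)` is the `hol(c′)`-CONJUGATE of the REVERSED loop holonomy
at the reflected bond `(α, y′)`, `y′ = bref α α y`, offset `bflip α L b`:
`hol_{G^σ}(loop_{(α,y),b}) = hol(rev c′) · hol(rev loop_{(α,y′),b̃}) · hol(c′)`. -/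
theorem holG_reflPair_loopCAt_self_eq (α : Fin d) (y : Fin d → ℤ) {b : Fin d → ℕ} (hb : b ∈ box d L) :
    holG (reflPair α G Gb) (reflPair α Gb G) (loopCAt (ctr d L) δ L α y b)
      = holG G Gb (rev (segUp δ ((L : ℤ) • bref α α y + ctr d L) α L))
        * holG G Gb (rev (loopCAt (ctr d L) δ L α (bref α α y) (bflip α L b)))
        * holG G Gb (segUp δ ((L : ℤ) • bref α α y + ctr d L) α L) := by
  have hc := lettersIn_segUp_top (δ : Form1 d (LetterGrp d)) ((L : ℤ) • bref α α y + ctr d L) α L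
  have hconj := holG_reflPair_loopCAt_self_conj hL hGGb hGbG α y hb
  have h1 := holG_rev_mul hGGb hGbG hc
  -- `H = (rev c′·c′) · H · (rev c′·c′) = rev c′ · (c′ · H · rev c′) · c′ = rev c′ · X · c′`
  calc holG (reflPair α G Gb) (reflPair α Gb G) (loopCAt (ctr d L) δ L α y b)
      = (holG G Gb (rev (segUp δ ((L : ℤ) • bref α α y + ctr d L) α L)) * holG G Gb (segUp δ ((L : ℤ) • bref α α y + ctr d L) α L))
        * holG (reflPair α G Gb) (reflPair α Gb G) (loopCAt (ctr d L) δ L α y b)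
        * (holG G Gb (rev (segUp δ ((L : ℤ) • bref α α y + ctr d L) α L)) * holG G Gb (segUp δ ((L : ℤ) • bref α α y + ctr d L) α L)) := by
        rw [h1, one_mul, mul_one]
    _ = holG G Gb (rev (segUp δ ((L : ℤ) • bref α α y + ctr d L) α L))
        * (holG G Gb (segUp δ ((L : ℤ) • bref α α y + ctr d L) α L)
          * holG (reflPair α G Gb) (reflPair α Gb G) (loopCAt (ctr d L) δ L α y b)
          * holG G Gb (rev (segUp δ ((L : ℤ) • bref α α y + ctr d L) α L)))
        * holG G Gb (segUp δ ((L : ℤ) • bref α α y + ctr d L) α L) := by simp only [mul_assoc]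
    _ = _ := by rw [hconj]

/-- [folklore] `μ = α`: the logarithm of each image loop holonomy is MINUS the `hol(c′)`-conjugated logarithm of the loop holonomy at the
reflected bond: `logT hol_{G^σ}(loop_{(α,y),b}) = hol(rev c′) · (−logT hol(loop_{(α,y′),b̃})) · hol(c′)`. -/
theorem logT_holG_reflPair_loopCAt_self (α : Fin d) (y : Fin d → ℤ) {b : Fin d → ℕ} (hb : b ∈ box d L) :
    logT 𝕜 (holG (reflPair α G Gb) (reflPair α Gb G) (loopCAt (ctr d L) δ L α y b))
      = holG G Gb (rev (segUp δ ((L : ℤ) • bref α α y + ctr d L) α L))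
        * (-logT 𝕜 (holG G Gb (loopCAt (ctr d L) δ L α (bref α α y) (bflip α L b))))
        * holG G Gb (segUp δ ((L : ℤ) • bref α α y + ctr d L) α L) := by
  have hc := lettersIn_segUp_top (δ : Form1 d (LetterGrp d)) ((L : ℤ) • bref α α y + ctr d L) α L
  rw [holG_reflPair_loopCAt_self_eq hL hGGb hGbG α y hb,
    AveragingThirdJet.logT_conj (𝕜 := 𝕜) (holG_rev_mul hGGb hGbG hc) (holG_mul_rev hGGb hGbG hc),
    logT_holG_rev h4 hG hGb hGGb hGbG h2 (lettersIn_loopCAt_top (ctr d L) δ L α (bref α α y) (bflip α L b))]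

/-- [folklore] `μ = α`: the block-averaged logarithm at `(α, y)` of the reflected pair is MINUS the `hol(c′)`-conjugate of the block-averaged
logarithm at the reflected bond (offsets re-indexed by `bflip α L`). -/
theorem avgLog_reflPair_self (α : Fin d) (y : Fin d → ℤ) :
    ((L : 𝕜) ^ d)⁻¹ • ∑ b ∈ box d L, logT 𝕜 (holG (reflPair α G Gb) (reflPair α Gb G) (loopCAt (ctr d L) δ L α y b))
      = holG G Gb (rev (segUp δ ((L : ℤ) • bref α α y + ctr d L) α L))
        * (-(((L : 𝕜) ^ d)⁻¹ • ∑ b ∈ box d L, logT 𝕜 (holG G Gb (loopCAt (ctr d L) δ L α (bref α α y) b))))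
        * holG G Gb (segUp δ ((L : ℤ) • bref α α y + ctr d L) α L) := by
  have hsum : ∑ b ∈ box d L, logT 𝕜 (holG (reflPair α G Gb) (reflPair α Gb G) (loopCAt (ctr d L) δ L α y b))
      = ∑ b ∈ box d L, holG G Gb (rev (segUp δ ((L : ℤ) • bref α α y + ctr d L) α L))
        * (-logT 𝕜 (holG G Gb (loopCAt (ctr d L) δ L α (bref α α y) b)))
        * holG G Gb (segUp δ ((L : ℤ) • bref α α y + ctr d L) α L) := by
    rw [← sum_box_bflip α L (fun b => holG G Gb (rev (segUp δ ((L : ℤ) • bref α α y + ctr d L) α L))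
        * (-logT 𝕜 (holG G Gb (loopCAt (ctr d L) δ L α (bref α α y) b)))
        * holG G Gb (segUp δ ((L : ℤ) • bref α α y + ctr d L) α L))]
    exact Finset.sum_congr rfl fun b hb => logT_holG_reflPair_loopCAt_self h4 h2 hL hG hGb hGGb hGbG α y hb
  rw [hsum, ← Finset.sum_mul, ← Finset.mul_sum, Finset.sum_neg_distrib, ← smul_mul_assoc, ← mul_smul_comm, smul_neg]

/-- [folklore] **THE STRUCTURE OF THE REFLECTED AVERAGING ON THE AXIS**: `Φ^{ρ_c}_{(α,y)}(G^σ, Ḡ^σ) = hol(rev c′) · expT(−x_{(α,y′)})`,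
`x_{(α,y′)} = L^{−d} • Σ_b logT hol(loop_{(α,y′),b})`, `c′` the centred closing segment of `(α, y′)`, `y′ = bref α α y`. -/
theorem PhiGAt_reflPair_self_eq (α : Fin d) (y : Fin d → ℤ) :
    PhiGAt 𝕜 (ctr d L) (reflPair α G Gb) (reflPair α Gb G) L α y
      = holG G Gb (rev (segUp δ ((L : ℤ) • bref α α y + ctr d L) α L))
        * expT 𝕜 (-(((L : 𝕜) ^ d)⁻¹ • ∑ b ∈ box d L, logT 𝕜 (holG G Gb (loopCAt (ctr d L) δ L α (bref α α y) b)))) := by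
  have hc := lettersIn_segUp_top (δ : Form1 d (LetterGrp d)) ((L : ℤ) • bref α α y + ctr d L) α L
  rw [PhiGAt, avgLog_reflPair_self h4 h2 hL hG hGb hGGb hGbG α y,
    AveragingThirdJet.expT_conj (𝕜 := 𝕜) (holG_rev_mul hGGb hGbG hc) (holG_mul_rev hGGb hGbG hc),
    holG_reflPair_cSeg_self hL G Gb α y, mul_assoc, holG_mul_rev hGGb hGbG hc, mul_one]

/-! ## §3 THE μ = α LAW: the reflected averaging on the axis is the inverse of the averaging at the `bref`-partner -/

/-- [folklore] **THE μ = α GROUP-LEVEL INVERSION LAW** (an1's AN1-28B M2a §2, first product): for an inverse letter pair of augmentation one,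
`L` odd, root `ctr d L`:  `Φ_{(α,y)}(G^σ, Ḡ^σ) · Φ_{(α, bref α α y)}(G, Ḡ) = 1`. -/
theorem PhiGAt_reflPair_self_mul (α : Fin d) (y : Fin d → ℤ) :
    PhiGAt 𝕜 (ctr d L) (reflPair α G Gb) (reflPair α Gb G) L α y * PhiGAt 𝕜 (ctr d L) G Gb L α (bref α α y) = 1 := by
  have hc := lettersIn_segUp_top (δ : Form1 d (LetterGrp d)) ((L : ℤ) • bref α α y + ctr d L) α L
  have hx := aug_avgLog_eq_zero (𝕜 := 𝕜) hG hGb (ctr d L) L α (bref α α y)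
  rw [PhiGAt_reflPair_self_eq h4 h2 hL hG hGb hGGb hGbG α y, PhiGAt, mul_assoc, ← mul_assoc (expT 𝕜 _),
    expT_neg_mul_expT h4 h2 hx, one_mul, holG_rev_mul hGGb hGbG hc]

/-- [folklore] **THE μ = α GROUP-LEVEL INVERSION LAW**, swapped product: `Φ_{(α, bref α α y)}(G, Ḡ) · Φ_{(α,y)}(G^σ, Ḡ^σ) = 1`. -/
theorem mul_PhiGAt_reflPair_self (α : Fin d) (y : Fin d → ℤ) :
    PhiGAt 𝕜 (ctr d L) G Gb L α (bref α α y) * PhiGAt 𝕜 (ctr d L) (reflPair α G Gb) (reflPair α Gb G) L α y = 1 := by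
  have hc := lettersIn_segUp_top (δ : Form1 d (LetterGrp d)) ((L : ℤ) • bref α α y + ctr d L) α L
  have hx := aug_avgLog_eq_zero (𝕜 := 𝕜) hG hGb (ctr d L) L α (bref α α y)
  rw [PhiGAt_reflPair_self_eq h4 h2 hL hG hGb hGGb hGbG α y, PhiGAt, mul_assoc, ← mul_assoc (holG G Gb _),
    holG_mul_rev hGGb hGbG hc, one_mul, expT_mul_expT_neg h4 h2 hx]

/-- [folklore] **`Φ^σ_{(α,y)} = invT Φ_{(α,y′)}`**: the reflected averaging on the axis IS the truncated inverse of the averaging at the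
`bref`-partner (uniqueness of inverses modulo `𝔪⁴`; `ag Φ = 1` by the CUT's `aug_PhiGAt_eq_one`). -/
theorem PhiGAt_reflPair_self_eq_invT (α : Fin d) (y : Fin d → ℤ) :
    PhiGAt 𝕜 (ctr d L) (reflPair α G Gb) (reflPair α Gb G) L α y = invT (PhiGAt 𝕜 (ctr d L) G Gb L α (bref α α y)) :=
  eq_invT_of_mul_eq_one h4 (aug_PhiGAt_eq_one hG hGb (ctr d L) L α (bref α α y))
    (mul_PhiGAt_reflPair_self h4 h2 hL hG hGb hGGb hGbG α y)

/-- [folklore] The same law read at the reflected bond: `Φ_{(α, bref α α y)}(G^σ, Ḡ^σ) · Φ_{(α,y)}(G, Ḡ) = 1` (`bref α α` is an involution). -/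
theorem PhiGAt_reflPair_bref_mul (α : Fin d) (y : Fin d → ℤ) :
    PhiGAt 𝕜 (ctr d L) (reflPair α G Gb) (reflPair α Gb G) L α (bref α α y) * PhiGAt 𝕜 (ctr d L) G Gb L α y = 1 := by
  have h := PhiGAt_reflPair_self_mul h4 h2 hL hG hGb hGGb hGbG α (bref α α y)
  rwa [ResolventReflection.bref_bref] at h

end Axis

end Summit.QuantumFields.BalabanUV.Beta.RootedAveragingInversion
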